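import Summits.BirchSwinnertonDyer.BirchSwinnertonDyer.Theorems.AdditiveBranchIMCGordTwoRankZeroCompanionDoors
import Summits.BirchSwinnertonDyer.Rank1Residual.Additive.N10IsogenyTransport
import HarnessLib

/-!
# Crux `GordTwoRankZeroOffCaseOne` (item 19357), cell (G-ord, `e = 2`) ∩ `r_an = 0`: ONE booking door for the rows with
# `p ∤ #Ш(E)_an` — `BSD(E,p)` at every `p ≥ 5` with onto image from the UPPER half alone, and its isogeny-class form

Cell `bsd-addord`, seat `bsd-addord-k1-c2` (D-0074 row B1), gen 5. HONEST FRAMING: THEOREMS ONLY (no definition, no named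
fact, no `sorry`); nothing booked by this file; the Birch–Swinnerton-Dyer conjecture is not proved by any of this, and the
crux `GordTwoRankZeroOffCaseOne` (the Λ-adic LOWER half on the CONTENT rows, `ord_p #Ш_an = 2`) stays OPEN at class level.

## The observation

On X4♯(G-ord, `e = 2`) ∩ surj ∩ `r_an = 0` at `p ≥ 5` the UPPER half `ord_p #Ш(E) ≤ ord_p #Ш(E)_an` is the tree theorem
`Addv.missingUpperBoundAt_rankZero_of_semistableTwist_of_surj` (additive-p1/p2, `Additive/GordCycLeadingTermSemistableTwist.lean`:
Kato 2004 Thm. 17.4 (3) on the `ω^{(p−1)/2}`-component of the good ORDINARY twist `V`, `E = C • V^{(p*)}`, + Delbourgo 1998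
Prop. 4 + Pal's twist period + GZK + modularity; NO Tamagawa hypothesis: Prop. 4 carries `∏_{ν≠p} c_ν` on the algebraic
side and `c_p ≤ 4` is a `p`-unit). On a row with `ord_p #Ш(E)_an ≤ 0` the LOWER half `ord_p #Ш_an ≤ ord_p #Ш` is TRIVIAL
(`padicValNat ≥ 0`). Hence `BSD(E,p)` on every such row from DATA binders only — no partner, no witness, no engine value:
cell membership (`ClassX4Gord W p`, `semistabilityIndex W p = 2` — or `N10.CellGordTwo W p`), `Surj W p`, `r_an = 0` and
the datum `#Ш(E)_an = q`, `ord_p q ≤ 0` (Cremona). These are the "non-content" rows of the crux (k1-c2 gens 0–4: "trivial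
for the lower half"); census (v5 book230 `L0_R242` × Cremona, this seat, HOME/k1-c2/records/big/census_w0.json): 3 121
(class, `p ≥ 5`) rows of this shape, of which 232 classes are L0 `residue` and 360 `literal` today. (The tree's
Delbourgo-FREE rank-0 doors on this cell, `ClassX4Gord.bsdp_rankZero_of_katoComponent_of_surj_of_prop414_of_shaAn_unit`
and `X4RankZero.bsdp_of_facts_of_shaAn_unit_of_five_le`, both need `p ∤ ∏ c_ℓ`; the rows left open are exactly the
`p ∣ ∏ c_ℓ` ("TAM") rows, which the Delbourgo road does not exclude.)

## What

* `bsdp_rankZero_surj_of_cellGordTwo_of_shaAnUnit` — `N10.CellGordTwo W p`, `Surj W p`, `5 ≤ p`, `r_an = 0`,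
  `#Ш_an = q` with `ord_p q ≤ 0` ⟹ `BSDp W p`, modulo the named facts `hK hDel98 hPal hGZK hmod hmodD` (exactly the
  upper-half binders of every gen-4/gen-5 companion record).
* `bsdp_rankZero_surj_of_classX4Gord_of_shaAnUnit` — the same keyed by `ClassX4Gord W p` + `semistabilityIndex W p = 2`
  (the k1-c3 booking-table currency).
* `isogenous_bsdp_rankZero_surj_of_classX4Gord_of_shaAnUnit` — ISOGENY-CLASS form (Cassels, `hCassels`, via the cell's
  `N10.bsdp_of_isIsogenous_of_bsdp`): `BSD(E',p)` for every globally minimal `E'` `ℚ`-isogenous to the door's member.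
* the trivial lower half is the tree's `N10.missingLowerBoundAt_of_padicValRat_le_zero` (`Additive/N10LowerHalfStatements.lean`).

References: Kato 2004 Thm. 17.4 (3) [Kato2004Asterisque]; Wuthrich 2014 Thm. 16 [Wuthrich2014]; Delbourgo 1998 Prop. 4
[Delbourgo1998]; Pal 2012 Thm. 3.2 [Pal2012]; Milne ADT Thm. I.7.3 (Cassels) [MilneADT2006]; Miller 2011 Def. 1.1 [Miller2011LMS].
-/

set_option autoImplicit false

noncomputable section

open scoped Classical

open WeierstrassCurve Literature.NumberTheory.EllipticCurves
  Literature.NumberTheory.EllipticCurves.Rank1Residual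
  Literature.NumberTheory.EllipticCurves.Rank1Residual.Typed
  Literature.NumberTheory.EllipticCurves.Wuthrich2014
  Literature.NumberTheory.EllipticCurves.MazurRubin2015
  Literature.NumberTheory.GaloisRepresentations
  Summit.BirchSwinnertonDyer.Rank1Residual.GaloisImage
open NumberField IsDedekindDomain Rat.HeightOneSpectrum Field
  Literature.NumberTheory.EllipticCurves.ModularForms

set_option linter.dupNamespace false

namespace Summit.BirchSwinnertonDyer.BirchSwinnertonDyer.Theorems.AdditiveBranchIMCGordTwoRankZeroCompanion

open Summit.BirchSwinnertonDyer.Rank1Residual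
open Summit.BirchSwinnertonDyer.Rank1Residual.Additive

section ShaAnUnit

variable {W : WeierstrassCurve ℚ} [W.IsElliptic] [W.IsGloballyMinimal] {p : ℕ} [hp : Fact p.Prime]

/-- **`BSD(E,p)` on cell (G-ord, `e = 2`) ∩ surj ∩ `r_an = 0` at `p ≥ 5` for the rows with `p ∤ #Ш(E)_an`** — the UPPER
half (`Addv.missingUpperBoundAt_rankZero_of_semistableTwist_of_surj`: Kato's half-eigenspace reading on the good ordinary
twist, Delbourgo 1998 Prop. 4, Pal, GZK, modularity — named facts `hK hDel98 hPal hGZK hmod hmodD`) plus the trivial lower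
half. Inputs per row are DATA: `N10.CellGordTwo W p`, `Surj W p`, `r_an = 0`, `#Ш_an = q` with `ord_p q ≤ 0`. Per pair /
per key; NOT the crux (whose content rows have `ord_p #Ш_an = 2`); nothing booked by this file.
[cite: Kato2004Asterisque, Thm. 17.4 (3) (p. 273)] [cite: Delbourgo1998, Prop. 4 (p. 144)] [cite: Pal2012, Thm. 3.2]
[cite: Miller2011LMS, Def. 1.1] -/
theorem bsdp_rankZero_surj_of_cellGordTwo_of_shaAnUnit
    (hK : Wuthrich2014.kato_halfEigenCharIdeal_dvd_cyclotomicPrime_of_surjective)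
    (hDel98 : Delbourgo1998.prop4_rankZero_pow_dvd_constantCoeff)
    (hPal : Pal2012.thm32_sqrt_mul_realPeriodRat_twist_eq_of_prime_one_mod_four)
    (hGZK : rank_eq_analyticRank_of_analyticRank_le_one)
    (hmod : hasEntireLFunction_rat) (hmodD : nonempty_modularParametrizationData)
    (hp5 : 5 ≤ p) (hc : N10.CellGordTwo W p) (hsurj : Surj W p) (hr : W.analyticRank = 0)
    {q : ℚ} (hq : shaAn W = (q : ℂ)) (hv : padicValRat p q ≤ 0) : BSDp W p := by
  obtain ⟨hp2, hadd, hG, he⟩ := hc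
  obtain ⟨V, _, _, C, hVord, hWV⟩ := TypeGOrd.exists_goodOrd_pStar_twist_model W p hp2 hG hadd he
  exact bsdp_of_missingPPartAt W p hGZK (by omega)
    (missingPPartAt_of_lower_of_upper W p (N10.missingLowerBoundAt_of_padicValRat_le_zero W p hq hv)
      (Addv.missingUpperBoundAt_rankZero_of_semistableTwist_of_surj hK hDel98 hPal hGZK hmod hmodD hp5
        hadd V C hWV (Or.inl hVord) hsurj hr))

/-- **The same door in the booking-table currency** `ClassX4Gord W p` + `semistabilityIndex W p = 2` (as k1-c3's
X4♯ r1 doors): `BSD(E,p)`, `p ≥ 5`, onto image, `r_an = 0`, `#Ш_an = q` with `ord_p q ≤ 0`.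
[cite: Kato2004Asterisque, Thm. 17.4 (3) (p. 273)] [cite: Delbourgo1998, Prop. 4 (p. 144)] [cite: Miller2011LMS, Def. 1.1] -/
theorem bsdp_rankZero_surj_of_classX4Gord_of_shaAnUnit
    (hK : Wuthrich2014.kato_halfEigenCharIdeal_dvd_cyclotomicPrime_of_surjective)
    (hDel98 : Delbourgo1998.prop4_rankZero_pow_dvd_constantCoeff)
    (hPal : Pal2012.thm32_sqrt_mul_realPeriodRat_twist_eq_of_prime_one_mod_four)
    (hGZK : rank_eq_analyticRank_of_analyticRank_le_one)
    (hmod : hasEntireLFunction_rat) (hmodD : nonempty_modularParametrizationData)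
    (hp5 : 5 ≤ p) (hX : ClassX4Gord W p) (he : semistabilityIndex W p = 2) (hsurj : Surj W p)
    (hr : W.analyticRank = 0) {q : ℚ} (hq : shaAn W = (q : ℂ)) (hv : padicValRat p q ≤ 0) : BSDp W p :=
  bsdp_rankZero_surj_of_cellGordTwo_of_shaAnUnit hK hDel98 hPal hGZK hmod hmodD hp5
    ⟨hX.addv.1, hX.addv.2, hX.typeGOrd, he⟩ hsurj hr hq hv

/-- **ISOGENY-CLASS form**: for every globally minimal `E'` `ℚ`-isogenous to the door's member `E` (X4♯(G-ord) ∩ `I₀*` ∩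
surj at `p ≥ 5`, `r_an = 0`, `p ∤ #Ш(E)_an`), `BSD(E',p)` — Cassels' isogeny invariance (`hCassels`, the cell's
`N10.bsdp_of_isIsogenous_of_bsdp`; the analytic rank is an isogeny invariant unconditionally). This is the shape a CLASS
booking names. [cite: MilneADT2006, Thm. I.7.3 and Remark I.7.4] [cite: Kato2004Asterisque, Thm. 17.4 (3) (p. 273)]
[cite: Delbourgo1998, Prop. 4 (p. 144)] [cite: Miller2011LMS, §1 and Def. 1.1] -/
theorem isogenous_bsdp_rankZero_surj_of_classX4Gord_of_shaAnUnit
    (hCassels : bsdRHS_eq_of_isIsogenous)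
    (hK : Wuthrich2014.kato_halfEigenCharIdeal_dvd_cyclotomicPrime_of_surjective)
    (hDel98 : Delbourgo1998.prop4_rankZero_pow_dvd_constantCoeff)
    (hPal : Pal2012.thm32_sqrt_mul_realPeriodRat_twist_eq_of_prime_one_mod_four)
    (hGZK : rank_eq_analyticRank_of_analyticRank_le_one)
    (hmod : hasEntireLFunction_rat) (hmodD : nonempty_modularParametrizationData)
    {W' : WeierstrassCurve ℚ} [W'.IsElliptic] [W'.IsGloballyMinimal] (hiso : IsIsogenous W' W)
    (hp5 : 5 ≤ p) (hX : ClassX4Gord W p) (he : semistabilityIndex W p = 2) (hsurj : Surj W p)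
    (hr : W.analyticRank = 0) {q : ℚ} (hq : shaAn W = (q : ℂ)) (hv : padicValRat p q ≤ 0) : BSDp W' p := by
  have hr' : W'.analyticRank ≤ 1 := by rw [analyticRank_eq_of_isIsogenous' hiso, hr]; norm_num
  exact N10.bsdp_of_isIsogenous_of_bsdp p hCassels hGZK hmod hiso hr'
    (bsdp_rankZero_surj_of_classX4Gord_of_shaAnUnit hK hDel98 hPal hGZK hmod hmodD hp5 hX he hsurj hr hq hv)

end ShaAnUnit

end Summit.BirchSwinnertonDyer.BirchSwinnertonDyer.Theorems.AdditiveBranchIMCGordTwoRankZeroCompanion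

end
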